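import Literature.AnabelianGeometry.SemiGraphs.CoverticialEdgeCase
import Literature.AnabelianGeometry.SemiGraphs.CyclicCoveringConnected

/-!
# [SemiAnbd] Proposition 2.6, edge case: a coverticial pair in `ℍ ∖ 𝕂` (p. 29)

Mochizuki, *Semi-graphs of anabelioids*, Publ. RIMS **42** (2006) 221–322, §2, proof of
Proposition 2.6, p. 29 [cite: MochizukiSemiAnbd2006, Prop. 2.6 p.29]: "it suffices … to show
that `Π_𝕂 ∩ Π_ℍ` has infinite index in `Π_ℍ` under the assumption that `ℍ` contains a pair of
distinct coverticial edges `e_a`, `e_b`, neither of which is contained in `𝕂`" — proved via the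
degree-`M` cyclic graph-coverings, trivial over `𝕂` and connected over the loop `L = {e_a, e_b}`.

`relIndex_conj_piK_piH_eq_zero_of_coverticial` is exactly this statement, UNCONDITIONALLY, in the
notation of `proposition_2_6` (`Coverticial.lean`): for a graph of anabelioids `𝒢` (underlying
semi-graph a graph), sub-semi-graphs `ℍ` (connected) and `𝕂`, distinct coverticial edges
`e_a, e_b ∈ ℍ` with `e_a ∉ 𝕂` and the end-vertices of `e_a` in `ℍ` (i.e. `ℍ` is a subGRAPH at
`e_a`, as in print), and any basepoints, `[Π_ℍ : Π_ℍ ∩ g Π_𝕂 g⁻¹] = ∞` for every `g ∈ Π_𝒢`.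
It combines `CoverticialEdgeCase.lean` (the count, given connectedness over `ℍ` of the cyclic
coverings) with `CyclicCoveringConnected.lean` (that connectedness).  Only `e_a ∉ 𝕂` is used (not
`e_b ∉ 𝕂`), and neither the connectedness of `𝕂` nor quasi-coherence.  Proof-only, no definitions.
-/

namespace Literature.AnabelianGeometry.SemiGraphs

namespace SemiGraphOfAnabelioids

open CategoryTheory CategoryTheory.Limits
open scoped Pointwise

universe v₁ u₁ u

variable (𝒢 : SemiGraphOfAnabelioids.{v₁, u₁, u})

/-- **[SemiAnbd] Prop. 2.6, the coverticial-pair case (p. 29)**: if the connected sub-semi-graph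
`ℍ` contains two distinct coverticial edges `e_a ≠ e_b` together with the end-vertices of `e_a`,
and `e_a ∉ 𝕂`, then for all basepoints and every `g ∈ Π_𝒢` the subgroup `Π_ℍ ∩ g Π_𝕂 g⁻¹` has
infinite index in `Π_ℍ` (`relIndex = 0`). [cite: MochizukiSemiAnbd2006, Prop. 2.6 p.29] -/
theorem relIndex_conj_piK_piH_eq_zero_of_coverticial (hg : 𝒢.graph.IsGraph)
    (H K : 𝒢.graph.Subgraph) (hH : H.toSemiGraph.IsConnected) {e_a e_b : 𝒢.graph.Edge}
    (hne : e_a ≠ e_b) (hcov : 𝒢.graph.Coverticial e_a e_b) (ha : e_a ∈ H.edges)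
    (hb : e_b ∈ H.edges) (haK : e_a ∉ K.edges)
    (hHa : ∀ v, 𝒢.graph.EdgeAbuts e_a v → v ∈ H.verts)
    (w : H.toSemiGraph.Vertex) (F : 𝒢.V w.1 ⥤ FintypeCat.{v₁}) [PreGaloisCategory.FiberFunctor F]
    (w' : K.toSemiGraph.Vertex) (F' : 𝒢.V w'.1 ⥤ FintypeCat.{v₁})
    [PreGaloisCategory.FiberFunctor F'] (α : 𝒢.ρ w'.1 ⋙ F' ≅ 𝒢.ρ w.1 ⋙ F) (g : 𝒢.Pi w.1 F) :
    (ConjAct.toConjAct g • ((Aut.autMulEquivOfIso α).toMonoidHom.comp (𝒢.piHToPi K w' F')).range).relIndex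
      (𝒢.piHToPi H w F).range = 0 := by
  -- the two branches `b₀ → v₀`, `b₀′ → v₁` of `e_a` (a closed edge of the graph `𝔾`)
  obtain ⟨b₀, b₀', hbb, hb₀, hb₀', -⟩ := 𝒢.graph.two_branches e_a
  obtain ⟨v₀, h₀⟩ := Option.isSome_iff_exists.mp (hg.abuts_isSome b₀)
  obtain ⟨v₁, h₁⟩ := Option.isSome_iff_exists.mp (hg.abuts_isSome b₀')
  have hv₀ : v₀ ∈ H.verts := hHa v₀ ⟨b₀, hb₀, h₀⟩
  have hv₁ : v₁ ∈ H.verts := hHa v₁ ⟨b₀', hb₀', h₁⟩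
  -- the branches `c → v₀`, `c′ → v₁` of the coverticial edge `e_b`
  obtain ⟨c, hc, hcv⟩ := (hcov.2.2 v₀).mp ⟨b₀, hb₀, h₀⟩
  obtain ⟨c', hc', hcv'⟩ := (hcov.2.2 v₁).mp ⟨b₀', hb₀', h₁⟩
  subst hb₀
  refine 𝒢.relIndex_conj_piK_piH_eq_zero_of_cyclicCovers hg H K hH b₀ haK (fun M hM => ?_)
    w F w' F' α g
  haveI : NeZero M := ⟨Nat.pos_iff_ne_zero.mp hM⟩
  exact 𝒢.graph.cyclicCover_preimage_isConnected b₀ M H hH hv₀ hv₁ ha h₀ (Ne.symm hbb) hb₀' h₁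
    (by rw [hc]; exact Ne.symm hne) (by rw [hc', hc]) (by rw [hc]; exact hb) hcv hcv'

end SemiGraphOfAnabelioids

end Literature.AnabelianGeometry.SemiGraphs
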